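import Literature.AlgebraicGeometry.Resolution.LogRefinedChartTorus
import Literature.AlgebraicGeometry.Resolution.LogChartEmbeddingRank
import HarnessLib

/-!
# The twisting units and the refinement map at a point of a refined toric chart — Kato (10.3)

`Literature/AlgebraicGeometry/Resolution/LogRefinedChartRefine.lean`. Continuation of
`LogRefinedChartTorus.lean` (K. Kato, *Toric singularities*, Amer. J. Math. 116 (1994),
(10.3)): with a sharp embedding `e` of `P` at the face `F_𝔭` (`LogChartEmbeddedReduction`) and
the splitting `π₀` of the face group,

* `twistUnits` — `u(e p) = X^{b′(p)} ∈ A₁ˣ` (well defined since `b′` kills `ℤF_𝔭`), with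
  `u(0) = 1` and `u` multiplicative on `P′ = e(P)`;
* `refineMap` — `c(e p) = (bᵢ*(p))_{i ∉ U} ∈ ℕ^N`, additive on `P′`, kernel-free and with finite
  fibres: the hypotheses `hc0`, `hadd`, `hc`, `hfin` of the refinement theorems
  (`LogRegularCompleteStructure.isRegularLocalRing_localization_closedPoint_of_le`);
* `exists_dformData_proj'` — the d-form data of the chart over `A_𝔭` for the ADAPTED splitting
  `π'` (`LogChartEmbeddedReduction.embChart_dform`).

References: [Kato1994] K. Kato, Toric singularities, Amer. J. Math. 116 (1994), (10.3).
-/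

noncomputable section

open IsLocalRing

namespace Literature.AlgebraicGeometry.Resolution

namespace LogRefinedChart

universe u

variable {n : ℕ} {A : Type u} [CommRing A] {P : AddSubmonoid (Fin n → ℤ)}
  {φ : Multiplicative P →* A} {C : Type u} [CommRing C] [Algebra A C]
  {Q : AddSubmonoid (Fin n → ℤ)} {b : Module.Basis (Fin n) ℤ (Fin n → ℤ)} {I : Finset (Fin n)}
  (hQ : IsOrthantLike b I Q) (χ : Multiplicative Q →* C) (𝔓 : Ideal C) [𝔓.IsPrime]
  (hPQ : P ≤ Q)
  (hχ : ∀ p : P, χ (Multiplicative.ofAdd ⟨(p : Fin n → ℤ), hPQ p.2⟩) =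
    algebraMap A C (φ (Multiplicative.ofAdd p)))
  (π₀ : (Fin n → ℤ) →ₗ[ℤ] (Fin n → ℤ))
  (hπ₀0 : ∀ v ∈ Submodule.span ℤ
    (LogChart.faceMonoid P φ (𝔓.comap (algebraMap A C)) : Set (Fin n → ℤ)), π₀ v = 0)
  (hπ₀1 : ∀ v, v - π₀ v ∈ Submodule.span ℤ
    (LogChart.faceMonoid P φ (𝔓.comap (algebraMap A C)) : Set (Fin n → ℤ)))
  (hπ₀2 : ∀ v, π₀ (π₀ v) = π₀ v)
  {e : (Fin n → ℤ) →+ (Fin n → ℤ)}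
  (he : LogChart.IsSharpEmbedding P (LogChart.faceMonoid P φ (𝔓.comap (algebraMap A C))) e)

/-! ### The twisting units `u(e p) = X^{b′(p)}` -/

open Classical in
/-- **The twisting units** `u : ℕ^{(n)} → A₁ˣ`, `u(e p) = X^{b′(p)}` on `P′ = e(P)` and `1`
elsewhere. [cite: Kato1994, (10.3)] -/
def twistUnits (w : Fin n →₀ ℕ) : (TorusLoc A hQ χ 𝔓 π₀)ˣ :=
  if h : ∃ p : P, LogChart.embHom he p = w then
    Additive.toMul (torusMonomial A hQ χ 𝔓 π₀ (h.choose : Fin n → ℤ))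
  else 1

include hPQ hχ hπ₀0 in
/-- `b′` is constant on the fibres of `e|_P` (they differ by the face group).
[cite: Kato1994, (10.3)] -/
theorem torusMonomial_eq_of_embHom_eq {p q : P} (h : LogChart.embHom he p = LogChart.embHom he q) :
    torusMonomial A hQ χ 𝔓 π₀ (p : Fin n → ℤ) = torusMonomial A hQ χ 𝔓 π₀ (q : Fin n → ℤ) := by
  rw [LogChart.embHom_eq_iff he] at h
  have hspan := he.inj _ p.2 _ q.2 h
  have h0 : torusCoord hQ χ 𝔓 π₀ ((p : Fin n → ℤ) - q) = 0 :=
    torusCoord_eq_zero_of_mem_span hQ χ 𝔓 hPQ hχ π₀ hπ₀0 hspan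
  rw [← sub_eq_zero, ← map_sub, torusMonomial_apply]
  exact Finset.sum_eq_zero fun k _ => by rw [h0, Finsupp.zero_apply, zero_smul]

include hPQ hχ hπ₀0 in
/-- `u(e p) = X^{b′(p)}`. [cite: Kato1994, (10.3)] -/
theorem twistUnits_embHom (p : P) :
    twistUnits hQ χ 𝔓 π₀ he (LogChart.embHom he p) =
      Additive.toMul (torusMonomial A hQ χ 𝔓 π₀ (p : Fin n → ℤ)) := by
  classical
  have hex : ∃ q : P, LogChart.embHom he q = LogChart.embHom he p := ⟨p, rfl⟩
  rw [twistUnits, dif_pos hex, torusMonomial_eq_of_embHom_eq hQ χ 𝔓 hPQ hχ π₀ hπ₀0 he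
    hex.choose_spec]

include hPQ hχ hπ₀0 in
/-- `u(0) = 1`. [cite: Kato1994, (10.3)] -/
theorem twistUnits_zero : twistUnits hQ χ 𝔓 π₀ he 0 = 1 := by
  rw [← map_zero (LogChart.embHom he), twistUnits_embHom hQ χ 𝔓 hPQ hχ π₀ hπ₀0 he,
    ZeroMemClass.coe_zero, map_zero, toMul_zero]

include hPQ hχ hπ₀0 in
/-- `u` is multiplicative on `P′`. [cite: Kato1994, (10.3)] -/
theorem twistUnits_add :
    ∀ a ∈ LogChart.embMonoid he, ∀ b ∈ LogChart.embMonoid he,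
      twistUnits hQ χ 𝔓 π₀ he (a + b) = twistUnits hQ χ 𝔓 π₀ he a * twistUnits hQ χ 𝔓 π₀ he b := by
  intro a ha b hb
  obtain ⟨p, rfl⟩ := (LogChart.mem_embMonoid he).1 ha
  obtain ⟨q, rfl⟩ := (LogChart.mem_embMonoid he).1 hb
  rw [← map_add, twistUnits_embHom hQ χ 𝔓 hPQ hχ π₀ hπ₀0 he,
    twistUnits_embHom hQ χ 𝔓 hPQ hχ π₀ hπ₀0 he, twistUnits_embHom hQ χ 𝔓 hPQ hχ π₀ hπ₀0 he,
    AddMemClass.coe_add, map_add, toMul_add]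

/-! ### The refinement map `c(e p) = (bᵢ*(p))_{i ∉ U}` -/

/-- The number `N` of non-unit indices (the number of `T`-variables). [cite: Kato1994, (10.3)] -/
def refineRank : ℕ := ((unitIdx hQ χ 𝔓)ᶜ).card

/-- Enumeration of the non-unit indices. [cite: Kato1994, (10.3)] -/
def nonUnitEquiv : ↥((unitIdx hQ χ 𝔓)ᶜ) ≃ Fin (refineRank hQ χ 𝔓) := Finset.equivFin _

/-- The `j`-th non-unit index. [cite: Kato1994, (10.3)] -/
def nonUnitIdx (j : Fin (refineRank hQ χ 𝔓)) : Fin n := ((nonUnitEquiv hQ χ 𝔓).symm j : Fin n)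

/-- Non-unit indices are not unit indices. [cite: Kato1994, (10.3)] -/
theorem nonUnitIdx_not_mem (j : Fin (refineRank hQ χ 𝔓)) : nonUnitIdx hQ χ 𝔓 j ∉ unitIdx hQ χ 𝔓 :=
  Finset.mem_compl.1 ((nonUnitEquiv hQ χ 𝔓).symm j).2

/-- `nonUnitIdx` is injective. [cite: Kato1994, (10.3)] -/
theorem nonUnitIdx_injective : Function.Injective (nonUnitIdx hQ χ 𝔓) := fun _ _ h =>
  (nonUnitEquiv hQ χ 𝔓).symm.injective (Subtype.ext h)

/-- Every non-unit index is enumerated. [cite: Kato1994, (10.3)] -/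
theorem exists_nonUnitIdx_eq {i : Fin n} (hi : i ∉ unitIdx hQ χ 𝔓) :
    ∃ j, nonUnitIdx hQ χ 𝔓 j = i :=
  ⟨nonUnitEquiv hQ χ 𝔓 ⟨i, Finset.mem_compl.2 hi⟩, by simp [nonUnitIdx]⟩

/-- The non-unit coordinates of a vector. [cite: Kato1994, (10.3)] -/
def refineCoord : (Fin n → ℤ) →+ (Fin (refineRank hQ χ 𝔓) → ℤ) where
  toFun x j := b.repr x (nonUnitIdx hQ χ 𝔓 j)
  map_zero' := by ext j; simp
  map_add' x y := by ext j; simp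

/-- `refineCoord` unfolded. [cite: Kato1994, (10.3)] -/
@[simp] theorem refineCoord_apply (x : Fin n → ℤ) (j : Fin (refineRank hQ χ 𝔓)) :
    refineCoord hQ χ 𝔓 x j = b.repr x (nonUnitIdx hQ χ 𝔓 j) := rfl

open Classical in
/-- **The refinement map** `c : ℕ^{(n)} → ℕ^N`, `c(e p) = (bᵢ*(p))_{i ∉ U}`, `0` off `P′`.
[cite: Kato1994, (10.3)] -/
def refineMap (w : Fin n →₀ ℕ) : Fin (refineRank hQ χ 𝔓) →₀ ℕ :=
  if h : ∃ p : P, LogChart.embHom he p = w then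
    Finsupp.equivFunOnFinite.symm fun j => (refineCoord hQ χ 𝔓 (h.choose : Fin n → ℤ) j).toNat
  else 0

include hPQ hχ in
/-- The non-unit coordinates are constant on the fibres of `e|_P`. [cite: Kato1994, (10.3)] -/
theorem refineCoord_eq_of_embHom_eq {p q : P} (h : LogChart.embHom he p = LogChart.embHom he q) :
    refineCoord hQ χ 𝔓 (p : Fin n → ℤ) = refineCoord hQ χ 𝔓 (q : Fin n → ℤ) := by
  rw [LogChart.embHom_eq_iff he] at h
  have hspan := he.inj _ p.2 _ q.2 h
  have hmem := span_faceMonoid_le_hsub hQ χ 𝔓 hPQ hχ hspan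
  rw [← sub_eq_zero, ← map_sub]
  ext j
  exact hmem _ (nonUnitIdx_not_mem hQ χ 𝔓 j)

include hPQ hχ in
/-- `c(e p)ⱼ = b*_{i_j}(p)`. [cite: Kato1994, (10.3)] -/
theorem refineMap_embHom (p : P) (j : Fin (refineRank hQ χ 𝔓)) :
    refineMap hQ χ 𝔓 he (LogChart.embHom he p) j =
      (b.repr (p : Fin n → ℤ) (nonUnitIdx hQ χ 𝔓 j)).toNat := by
  classical
  have hex : ∃ q : P, LogChart.embHom he q = LogChart.embHom he p := ⟨p, rfl⟩
  rw [refineMap, dif_pos hex, Finsupp.coe_equivFunOnFinite_symm,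
    refineCoord_eq_of_embHom_eq hQ χ 𝔓 hPQ hχ he hex.choose_spec, refineCoord_apply]

include hPQ in
/-- On `P` the non-unit coordinates are non-negative. [cite: Kato1994, (10.3)] -/
theorem repr_nonneg_of_mem {p : Fin n → ℤ} (hp : p ∈ P) (j : Fin (refineRank hQ χ 𝔓)) :
    0 ≤ b.repr p (nonUnitIdx hQ χ 𝔓 j) :=
  (hQ.mem_iff p).1 (hPQ hp) _ (mem_of_not_mem_unitIdx hQ χ 𝔓 (nonUnitIdx_not_mem hQ χ 𝔓 j))

include hPQ hχ in
/-- `c(e p)ⱼ = b*_{i_j}(p)` in `ℤ`. [cite: Kato1994, (10.3)] -/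
theorem refineMap_embHom_cast (p : P) (j : Fin (refineRank hQ χ 𝔓)) :
    ((refineMap hQ χ 𝔓 he (LogChart.embHom he p) j : ℕ) : ℤ) =
      b.repr (p : Fin n → ℤ) (nonUnitIdx hQ χ 𝔓 j) := by
  rw [refineMap_embHom hQ χ 𝔓 hPQ hχ he, Int.toNat_of_nonneg (repr_nonneg_of_mem hQ χ 𝔓 hPQ p.2 j)]

include hPQ hχ in
/-- `c(0) = 0`. [cite: Kato1994, (10.3)] -/
theorem refineMap_zero : refineMap hQ χ 𝔓 he 0 = 0 := by
  ext j
  rw [← map_zero (LogChart.embHom he), refineMap_embHom hQ χ 𝔓 hPQ hχ he, ZeroMemClass.coe_zero,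
    map_zero, Finsupp.zero_apply, Int.toNat_zero, Finsupp.zero_apply]

include hPQ hχ in
/-- `c` is additive on `P′`. [cite: Kato1994, (10.3)] -/
theorem refineMap_add :
    ∀ a ∈ LogChart.embMonoid he, ∀ b ∈ LogChart.embMonoid he,
      refineMap hQ χ 𝔓 he (a + b) = refineMap hQ χ 𝔓 he a + refineMap hQ χ 𝔓 he b := by
  intro a ha b' hb
  obtain ⟨p, rfl⟩ := (LogChart.mem_embMonoid he).1 ha
  obtain ⟨q, rfl⟩ := (LogChart.mem_embMonoid he).1 hb
  ext j
  apply Int.ofNat.inj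
  simp only [Int.ofNat_eq_natCast, Finsupp.add_apply, Nat.cast_add]
  rw [← map_add, refineMap_embHom_cast hQ χ 𝔓 hPQ hχ he, refineMap_embHom_cast hQ χ 𝔓 hPQ hχ he,
    refineMap_embHom_cast hQ χ 𝔓 hPQ hχ he, AddMemClass.coe_add, map_add, Finsupp.add_apply]

include hPQ hχ in
/-- **`c` is kernel-free**: `c(w) = 0` only for `w = 0` on `P′` (an element of `P` with vanishing
non-unit coordinates lies in the face, which `e` kills). [cite: Kato1994, (10.3)] -/
theorem refineMap_ne_zero :
    ∀ w ∈ LogChart.embMonoid he, w ≠ 0 → refineMap hQ χ 𝔓 he w ≠ 0 := by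
  intro w hw hw0 hc
  obtain ⟨p, rfl⟩ := (LogChart.mem_embMonoid he).1 hw
  apply hw0
  have hface : (p : Fin n → ℤ) ∈ LogChart.faceMonoid P φ (𝔓.comap (algebraMap A C)) := by
    rw [mem_faceMonoid_comap_iff hQ χ 𝔓 hPQ hχ]
    refine ⟨p.2, fun i hi => ?_⟩
    obtain ⟨j, rfl⟩ := exists_nonUnitIdx_eq hQ χ 𝔓 hi
    have h1 := refineMap_embHom_cast hQ χ 𝔓 hPQ hχ he p j
    rw [hc, Finsupp.zero_apply, Nat.cast_zero] at h1
    exact h1.symm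
  rw [← map_zero (LogChart.embHom he), LogChart.embHom_eq_iff he, ZeroMemClass.coe_zero, map_zero]
  exact he.map_face _ hface

include hPQ hχ in
/-- **`c` has finite fibres on `P′`**: in `c(e p) = α` the multiplicities of the generators of
`P` outside the face are bounded by `|α|`, and the generators inside the face are killed by `e`.
[cite: Kato1994, (10.3)] -/
theorem refineMap_finite_fibre (hP : P.FG) (α : Fin (refineRank hQ χ 𝔓) →₀ ℕ) :
    {w : Fin n →₀ ℕ | w ∈ LogChart.embMonoid he ∧ refineMap hQ χ 𝔓 he w = α}.Finite := by
  classical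
  obtain ⟨S, hS⟩ := hP
  set F := LogChart.faceMonoid P φ (𝔓.comap (algebraMap A C)) with hF
  set B : ℕ := ∑ j, α j with hB
  -- candidate exponent vectors: bounded multiplicities on the generators outside the face
  let cand : (↥S → Fin (B + 1)) → (Fin n → ℤ) := fun g => ∑ s : ↥S, ((g s : ℕ) : ℤ) • e (s : Fin n → ℤ)
  have hfin : (Set.range cand).Finite := Set.finite_range cand
  let toW : (Fin n → ℤ) → (Fin n →₀ ℕ) := fun v => Finsupp.equivFunOnFinite.symm fun i => (v i).toNat
  refine (hfin.image toW).subset ?_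
  rintro w ⟨hw, hcw⟩
  obtain ⟨p, rfl⟩ := (LogChart.mem_embMonoid he).1 hw
  -- write `p` on the generators
  have hpS : (p : Fin n → ℤ) ∈ AddSubmonoid.closure (S : Set (Fin n → ℤ)) := by rw [hS]; exact p.2
  obtain ⟨f, -, hf⟩ := AddSubmonoid.mem_closure_finset.1 hpS
  -- bound the multiplicities outside the face
  have hSP : ∀ s ∈ S, s ∈ P := fun s hs => by rw [← hS]; exact AddSubmonoid.subset_closure hs
  have hbound : ∀ s ∈ S, s ∉ F → f s ≤ B := by
    intro s hs hsF
    -- some non-unit coordinate of `s` is positive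
    have : ∃ i, i ∉ unitIdx hQ χ 𝔓 ∧ b.repr s i ≠ 0 := by
      by_contra hcon
      exact hsF ((mem_faceMonoid_comap_iff hQ χ 𝔓 hPQ hχ s).2
        ⟨hSP s hs, fun i hi => by by_contra h; exact hcon ⟨i, hi, h⟩⟩)
    obtain ⟨i, hi, hsi⟩ := this
    obtain ⟨j, rfl⟩ := exists_nonUnitIdx_eq hQ χ 𝔓 hi
    have hsi' : 1 ≤ b.repr s (nonUnitIdx hQ χ 𝔓 j) :=
      lt_of_le_of_ne (repr_nonneg_of_mem hQ χ 𝔓 hPQ (hSP s hs) j) hsi.symm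
    -- `α j = Σ_s f s · b*(s) ≥ f s`
    have hαj : ((α j : ℕ) : ℤ) = ∑ s' ∈ S, (f s' : ℤ) * b.repr s' (nonUnitIdx hQ χ 𝔓 j) := by
      rw [← hcw, refineMap_embHom_cast hQ χ 𝔓 hPQ hχ he, ← hf, map_sum, Finsupp.coe_finsetSum,
        Finset.sum_apply]
      refine Finset.sum_congr rfl fun s' _ => ?_
      rw [map_nsmul, Finsupp.smul_apply, nsmul_eq_mul]
    have h1 : (f s : ℤ) ≤ ∑ s' ∈ S, (f s' : ℤ) * b.repr s' (nonUnitIdx hQ χ 𝔓 j) := by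
      rw [← Finset.add_sum_erase _ _ hs]
      have h2 : (f s : ℤ) ≤ (f s : ℤ) * b.repr s (nonUnitIdx hQ χ 𝔓 j) :=
        le_mul_of_one_le_right (Int.natCast_nonneg _) hsi'
      have h3 : 0 ≤ ∑ s' ∈ S.erase s, (f s' : ℤ) * b.repr s' (nonUnitIdx hQ χ 𝔓 j) :=
        Finset.sum_nonneg fun s' hs' => mul_nonneg (Int.natCast_nonneg _)
          (repr_nonneg_of_mem hQ χ 𝔓 hPQ (hSP s' (Finset.mem_of_mem_erase hs')) j)
      linarith
    have h4 : (f s : ℤ) ≤ α j := by rw [hαj]; exact h1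
    have h5 : f s ≤ α j := by exact_mod_cast h4
    exact h5.trans (Finset.single_le_sum (fun j _ => Nat.zero_le (α j)) (Finset.mem_univ j))
  -- the truncated multiplicity function
  let g : ↥S → Fin (B + 1) := fun s =>
    ⟨if (s : Fin n → ℤ) ∈ F then 0 else f s, by
      split_ifs with h
      · exact Nat.succ_pos B
      · exact Nat.lt_succ_of_le (hbound s s.2 h)⟩
  have hep : e (p : Fin n → ℤ) = cand g := by
    rw [← hf, map_sum]
    rw [← Finset.sum_attach S]
    refine Finset.sum_congr rfl fun s _ => ?_
    rw [map_nsmul]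
    show f s • e (s : Fin n → ℤ) = (((if (s : Fin n → ℤ) ∈ F then 0 else f s : ℕ)) : ℤ) • e (s : Fin n → ℤ)
    split_ifs with h
    · rw [he.map_face _ h, smul_zero, smul_zero]
    · rw [natCast_zsmul]
  refine ⟨cand g, ⟨g, rfl⟩, ?_⟩
  -- `toW (e p) = embHom he p`
  ext i
  show ((cand g) i).toNat = LogChart.embHom he p i
  rw [← hep]
  apply Int.ofNat.inj
  rw [Int.ofNat_eq_natCast, Int.ofNat_eq_natCast, LogChart.embHom_apply_coe,
    Int.toNat_of_nonneg (he.nonneg _ p.2 i)]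

/-! ### The d-form data for the adapted splitting `π'` -/

include hPQ hχ hπ₀0 hπ₀1 in
/-- **Log regularity at `𝔭 = 𝔓 ∩ A` in d-form for the adapted splitting `π'`** (as
`LogChart.exists_dformData_of_isLogRegularAt'`, with `π'` in place of an arbitrary splitting).
[cite: Kato1994, Def. (2.1)] -/
theorem exists_dformData_proj' (hP : P.FG)
    (hreg : LogChart.IsLogRegularAt P φ (𝔓.comap (algebraMap A C))) :
    ∃ (d : ℕ) (t : Fin d → BaseLoc A 𝔓),
      LogChart.DFormData (LogChart.embMonoid he) (LogChart.embChart he (proj' hQ χ 𝔓 π₀)) d t ∧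
      ∀ p : P, ∃ v : (BaseLoc A 𝔓)ˣ,
        LogChart.embChart he (proj' hQ χ 𝔓 π₀) (LogChart.embHom he p) * ↑v =
          algebraMap A (BaseLoc A 𝔓) (LogChart.val P φ (p : Fin n → ℤ)) := by
  have hπ'0 : ∀ v ∈ Submodule.span ℤ
      (LogChart.faceMonoid P φ (𝔓.comap (algebraMap A C)) : Set (Fin n → ℤ)),
      proj' hQ χ 𝔓 π₀ v = 0 := fun v hv => proj'_eq_zero_of_mem_span hQ χ 𝔓 hPQ hχ π₀ hπ₀0 hv
  have hπ'1 := sub_proj'_mem_span hQ χ 𝔓 π₀ hπ₀1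
  obtain ⟨d, t, ht, hgen, hdim⟩ :=
    LogChart.exists_dform_of_isLogRegularAt P φ (𝔓.comap (algebraMap A C)) hreg
  obtain ⟨h0, hadd, hmax, hspan⟩ := LogChart.embChart_dform he hπ'0 hπ'1
  refine ⟨d, t, ⟨LogChart.embMonoid_fg he hP, h0, hadd, hmax, ht, ?_, ?_⟩,
    fun p => LogChart.exists_embChart_embHom_mul_eq he hπ'0 hπ'1 p⟩
  · rw [hspan]; exact hgen
  · rw [hdim]
    have h := Nat.add_le_add_right (LogChart.rank_embMonoid_le he) d
    rw [Nat.add_comm (n - _) d] at h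
    exact_mod_cast h

end LogRefinedChart

end Literature.AlgebraicGeometry.Resolution
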